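import Literature.AlgebraicGeometry.HodgeTheory.WeilClassesPolarizationOrthogonal
import Literature.AlgebraicGeometry.HodgeTheory.ClassesSupportedOn
import Literature.AlgebraicGeometry.HodgeTheory.WeilClasses
import Mathlib.Tactic.Ring
import Mathlib.Tactic.LinearCombination
import Mathlib.Tactic.Abel
import HarnessLib

/-!
# NSC(−2) · THE SEED SIEVE (prover 2 gen 33; carver C807 (b)/(e)(ii) clauses (S1)(S2), C815 (e)(ii) clause (S3)):
# what an integral Bloch seed `Z` with `c·[Z] = q·hⁿ + w` on a Weil `2n`-fold must meet, and the degree-8/10 bookkeeping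

Family `hodge`, b2b cell `hweil`, NSC programme (packet `run/shared/lean/b2b/hodge-weil/LADDER.md ## CARVER v132` C807 (b) THE SEED SIEVE,
`v134` C815 THE HIGHER SIEVE). Helper of item stmt-HodgeConjecture-2524. Literature imports only (`WeilClassesPolarizationOrthogonal`,
`ClassesSupportedOn`, `WeilClasses`); nothing of ring 2 is imported or restated. Def-free; 0 sorry.

* (S1) `nsc_sieve_weilClassesOf_map_eq_zero_of_dim_lt` — **Weil classes die on small `K`-stable abelian subvarieties**: for `ι : B ⟶ P`
  intertwining `ψ_B` (`ψ_B ≫ ψ_B = −d`) with `ψ₀` and `dim B < 2n`, `ι^* w = 0` for every `w ∈ weilClassesOf P ψ₀ n d`. Mechanism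
  (`nsc_sieve_pullbackEigenclasses_pow_eq_bot_of_dim_lt`): `ι^*` carries the Weil character `(x + yμ)²ⁿ` (`μ = ±i√d`) to the same
  character on `H²ⁿ(B) = ⋀²ⁿ H¹(B)`; in an eigenbasis of `H¹(B) = V_μ ⊕ V_{−μ}` (each of dimension `dim B < 2n`) every wedge monomial of
  degree `2n` contains a `(−μ)`-vector, so its character differs from `(x + yμ)²ⁿ` somewhere on `ℕ²`, and the joint eigenspace is `0`.
  This is C807 (b)(ii′)'s «`ι^*w = 0` because `ι^*E₊ = ⋀²ⁿ(ι^*V₊)` and `dim V₊(B) < 2n`».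
* (S2) `nsc_sieve_inter_nonempty_of_seedClass_of_cupPow_ne_zero` — **a seed meets every test cycle that `h^{n+k}` sees**: if
  `q·hⁿ + w` is supported on the closed set `Z`, `w` is a Weil class, `ψ₀^* h = d·h` (`h` is `K`-symmetric), `f` is supported on the
  closed set `V`, `q ≠ 0`, `k ≥ 1` and `h^{n+k} ⌣ f ≠ 0`, then `Z ∩ V ≠ ∅` — because `hᵏ ⌣ (q·hⁿ + w) = q·h^{n+k}` (`hᵏ ⌣ w = 0`,
  `cupProduct_cupPowTwo_eq_zero_of_map_eq_smul_of_mem_weilClassesOf`) while `hᵏ ⌣ (q hⁿ + w) ⌣ f` is supported on `Z ∩ V`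
  (`cupProduct_mem_classesSupportedOn_inter`) and `classesSupportedOn ∅ = 0`. C807 (b)(ii): «`Z` MEETS EVERY closed `V` of dimension
  `m ≥ n+1` with `∫[Z]·[V]·h^{m−n} ≠ 0`».
* (S3) the degree-8/10 bookkeeping of C815 (a)–(b) (= pv2-g7's CANONICAL-CLASS OBSTRUCTION (V)–(VII), `SEED-OBSTRUCTION.md` §3, kernel
  `Literature/…/WeilClassTestCanonicalObstruction.lean`, there at the tensor point) as pure algebra, def-free:
  `nsc_sieve_resolution_KZ_sq_add_c2` (on the resolution `Z ≅ Z(s) ⊂ ℙ(E)`: `K_Z = 2ξ + c₁F`, `c₂(T_Z) = 3ξ² + 3ξc₁F + c₁F² + c₂E − c₂F`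
  ⟹ `K_Z² + c₂(T_Z) = 7ξ² + 7c₁F·ξ + (2c₁F² + c₂E − c₂F)`), `nsc_sieve_pushforward_S8_S10` (with `i_*(x₀ + x₁ξ + x₂ξ²) = x₀c₃ + x₁c₄ + x₂c₅`,
  `c_k = c_k(F − E)`: `S₈ = i_*K_Z = 2c₄ + c₁F·c₃`, `S₁₀ = i_*(K_Z² + c₂T_Z) = 7c₅ + 7c₁F·c₄ + (2c₁F² + c₂E − c₂F)·c₃`),
  `nsc_sieve_grr_degrees_four_five` (`ch₄(i_*𝒪_Z) = −½S₈`, `ch₅ = S₁₀/12`: membership of `ch_k` in the line `ℚ·hᵏ` is membership of `S_k`),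
  and `nsc_sieve_coeff_eq_zero_of_mem_span` («`ch ∈ ℚ[h] ⊕ W` ⟹ the listed coefficient identities»: in any module, if the test
  monomials are linearly independent together with `hᵏ`, an element `a·hᵏ + Σ bᵢ·ηᵢ` lies on the line `ℚ·hᵏ` only if every `bᵢ = 0`).

HONEST FRAMING: (S1)(S2) are elementary consequences of two kernel facts of the Literature layer and of `H•(B) = ⋀•H¹`; (S3) is bookkeeping
(`ring` / linear independence) whose geometric dictionary (GRR with `td(P) = 1`, the resolution of a corank-one locus, Bloch (7.1)/(7.4) +
Artin + van Geemen 6.11/6.12 for the necessity) is pen-and-paper in the packet (C815 (a)) and is NOT asserted here. Nothing in this file is a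
rung, a case of the Hodge conjecture, or evidence for NSC(−2); no statement of [Markman 2025] / [Perry 2026] is used.
[cite: vanGeemen1994HodgeAV, 4.9, proof of Lemma 5.2 (6) and of Thm. 6.12] [cite: Fulton1998, §19.2 and §15.2] [cite: Bloch1972Semiregularity, (7.1), (7.4)]
-/

noncomputable section

-- mandated namespace `Summit.HodgeConjecture.HodgeConjecture.…` (Problem = Summit) trips `linter.dupNamespace`; the lakefile disables it
-- tree-wide (weak option), restated here so stand-alone elaboration is warning-free too.
set_option linter.dupNamespace false

open CategoryTheory
open Literature.AlgebraicGeometry Literature.AlgebraicGeometry.Motives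
open Literature.AlgebraicGeometry.HodgeTheory
open Literature.AlgebraicTopology.SingularHomology

namespace Summit.HodgeConjecture.HodgeConjecture.WeilTypeLadder

section NscSeedSieve

/-! ### (S1) Weil classes restrict to zero on `K`-stable abelian subvarieties of dimension `< 2n` -/

/-- Pulling back twice is pulling back along the composite, for morphisms of abelian varieties `f : B ⟶ A`, `g : A ⟶ C`:
`f^*(g^* c) = (f ≫ g)^* c`. [folklore] -/
theorem nsc_sieve_map_map_apply {A B C : AbelianVariety ℂ} {k : ℕ} (f : B ⟶ A) (g : A ⟶ C) (c : complexBetti C.X k) :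
    complexBetti.map f.hom.hom.hom k (complexBetti.map g.hom.hom.hom k c) = complexBetti.map (f ≫ g).hom.hom.hom k c := by
  change _ = singularCohomology.map ℂ ℂ (Motives.AlgPoints.mapContinuous (L := ℂ) (f.hom.hom.hom ≫ g.hom.hom.hom)) k c
  rw [Motives.AlgPoints.mapContinuous_comp, singularCohomology.map_comp]
  rfl

/-- **An intertwining morphism transports joint eigenclasses**: if `ι : B ⟶ P` satisfies `ι ≫ ψ₀ = ψ_B ≫ ι`, then `ι^*` maps the
`χ`-eigenclasses of `(P, ψ₀)` into the `χ`-eigenclasses of `(B, ψ_B)` (`(x·𝟙_B + y·ψ_B) ≫ ι = ι ≫ (x·𝟙_P + y·ψ₀)`). [folklore] -/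
theorem nsc_sieve_map_mem_pullbackEigenclasses {P B : AbelianVariety ℂ} {ψ₀ : P ⟶ P} {ψB : B ⟶ B} (ι : B ⟶ P)
    (hι : ι ≫ ψ₀ = ψB ≫ ι) {k : ℕ} {χ : ℕ → ℕ → ℂ} {c : complexBetti P.X k} (hc : c ∈ pullbackEigenclasses P ψ₀ k χ) :
    complexBetti.map ι.hom.hom.hom k c ∈ pullbackEigenclasses B ψB k χ := by
  rw [mem_pullbackEigenclasses_iff] at hc ⊢
  intro x y
  have hcomm : (x • 𝟙 B + y • ψB) ≫ ι = ι ≫ (x • 𝟙 P + y • ψ₀) := by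
    simp only [Preadditive.add_comp, Preadditive.comp_add, Preadditive.nsmul_comp, Preadditive.comp_nsmul,
      Category.id_comp, Category.comp_id, hι]
  change complexBetti.map (x • 𝟙 B + y • ψB).hom.hom.hom k (complexBetti.map ι.hom.hom.hom k c) = _
  rw [nsc_sieve_map_map_apply, hcomm, ← nsc_sieve_map_map_apply]
  change complexBetti.map ι.hom.hom.hom k
    (singularCohomology.map ℂ ℂ (Motives.AlgPoints.mapContinuous (L := ℂ) (x • 𝟙 P + y • ψ₀).hom.hom.hom) k c) = _
  rw [hc x y, map_smul]

/-- **No Weil character on a small abelian variety.** For an abelian variety `B` with `ψ ≫ ψ = −d` (`d ≥ 1`) and `dim B < 2n`, the joint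
eigenclasses of the `(x·𝟙 + y·ψ)^*` on `H²ⁿ(B(ℂ); ℂ)` for the character `(x + yμ)²ⁿ`, `μ = ±i√d`, are ZERO: in an eigenbasis of
`H¹(B) = V_μ ⊕ V_{−μ}` (both of dimension `dim B`) the wedge basis of `H²ⁿ = ⋀²ⁿ H¹` diagonalises the action with characters
`∏_{i ∈ S} (x + yλᵢ)`, `|S| = 2n > dim B`, so every `S` contains an index with `λᵢ = −μ` and its character is not `(x + yμ)²ⁿ`
(`exists_prod_natCast_add_mul_ne_pow`); all coordinates of a joint eigenvector vanish. [cite: vanGeemen1994HodgeAV, 4.9 and proof of Thm. 6.12] -/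
theorem nsc_sieve_pullbackEigenclasses_pow_eq_bot_of_dim_lt {B : AbelianVariety ℂ} {n d : ℕ} (hd : 0 < d) {ψ : B ⟶ B}
    (hψ : ψ ≫ ψ = -(d • 𝟙 B)) (hB : B.dim < 2 * n) {μ : ℂ}
    (hμ : μ = Complex.I * (Real.sqrt d : ℂ) ∨ μ = -(Complex.I * (Real.sqrt d : ℂ))) :
    (pullbackEigenclasses B ψ (2 * n) fun x y => ((x : ℂ) + (y : ℂ) * μ) ^ (2 * n)) = ⊥ := by
  classical
  rw [Submodule.eq_bot_iff]
  intro c hc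
  have hΛ : HasExteriorCohomologyH1 ℂ (Motives.ComplexPoints B.X) :=
    Motives.AbelianVariety.hasExteriorCohomologyH1_complexPoints B
  haveI := finite_complexBetti_abelianVariety B 1
  set m : ℕ := B.dim with hm
  have hb₁ : Module.finrank ℂ (complexBetti B.X 1) = 2 * m := Motives.AbelianVariety.finrank_complexBetti_one B
  set T := (complexBetti.map ψ.hom.hom.hom 1).hom with hT
  have hμ0 : μ ≠ 0 := by
    rcases hμ with rfl | rfl
    · exact I_mul_sqrt_ne_zero hd
    · exact neg_ne_zero.mpr (I_mul_sqrt_ne_zero hd)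
  -- `H¹ = V_μ ⊕ V_{-μ}`, both of dimension `m`
  have hps : Module.finrank ℂ (Module.End.eigenspace T (Complex.I * (Real.sqrt d : ℂ))) = m := by
    have h := two_mul_finrank_eigenspace_eq hd hψ
    rw [hb₁] at h
    change 2 * Module.finrank ℂ (Module.End.eigenspace T (Complex.I * (Real.sqrt d : ℂ))) = 2 * m at h
    omega
  have hqs : Module.finrank ℂ (Module.End.eigenspace T (-(Complex.I * (Real.sqrt d : ℂ)))) = m := by
    have h := finrank_eigenspace_eq_finrank_eigenspace_neg hd hψ
    change Module.finrank ℂ (Module.End.eigenspace T (Complex.I * (Real.sqrt d : ℂ))) =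
      Module.finrank ℂ (Module.End.eigenspace T (-(Complex.I * (Real.sqrt d : ℂ)))) at h
    rw [← h, hps]
  have hcompl : IsCompl (Module.End.eigenspace T μ) (Module.End.eigenspace T (-μ)) := by
    rcases hμ with rfl | rfl
    · exact isCompl_eigenspace_eigenspace_neg hd hψ
    · rw [neg_neg]; exact (isCompl_eigenspace_eigenspace_neg hd hψ).symm
  have hp : Module.finrank ℂ (Module.End.eigenspace T μ) = m := by
    rcases hμ with rfl | rfl
    · exact hps
    · exact hqs
  have hq : Module.finrank ℂ (Module.End.eigenspace T (-μ)) = m := by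
    rcases hμ with rfl | rfl
    · exact hqs
    · rw [neg_neg]; exact hps
  -- an eigenbasis of `H¹`, the `μ`-vectors first
  let bp := Module.finBasisOfFinrankEq ℂ (Module.End.eigenspace T μ) hp
  let bm := Module.finBasisOfFinrankEq ℂ (Module.End.eigenspace T (-μ)) hq
  let b₀ : Module.Basis (Fin m ⊕ Fin m) ℂ (complexBetti B.X 1) :=
    (bp.prod bm).map (Submodule.prodEquivOfIsCompl _ _ hcompl)
  let b : Module.Basis (Fin (m + m)) ℂ (complexBetti B.X 1) := b₀.reindex finSumFinEquiv
  let lam : Fin (m + m) → ℂ := fun i => Sum.elim (fun _ => μ) (fun _ => -μ) (finSumFinEquiv.symm i)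
  have hlam : ∀ i, lam i = μ ∨ lam i = -μ := fun i => by
    change Sum.elim (fun _ => μ) (fun _ => -μ) (finSumFinEquiv.symm i) = μ ∨
      Sum.elim (fun _ => μ) (fun _ => -μ) (finSumFinEquiv.symm i) = -μ
    rcases finSumFinEquiv.symm i with k | k
    · exact Or.inl rfl
    · exact Or.inr rfl
  have hb_mem : ∀ i, b i ∈ Module.End.eigenspace T (lam i) := by
    intro i
    rw [Module.Basis.reindex_apply]
    change b₀ (finSumFinEquiv.symm i) ∈
      Module.End.eigenspace T (Sum.elim (fun _ => μ) (fun _ => -μ) (finSumFinEquiv.symm i))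
    rcases finSumFinEquiv.symm i with k | k
    · simp only [Sum.elim_inl, b₀, Module.Basis.map_apply, Module.Basis.prod_apply, Function.comp_apply,
        LinearMap.inl_apply, Submodule.coe_prodEquivOfIsCompl', Submodule.coe_zero, add_zero]
      exact (bp k).2
    · simp only [Sum.elim_inr, b₀, Module.Basis.map_apply, Module.Basis.prod_apply, Function.comp_apply,
        LinearMap.inr_apply, Submodule.coe_prodEquivOfIsCompl', Submodule.coe_zero, zero_add]
      exact (bm k).2
  -- the `μ`-indices are the first block: `lam i = μ` forces `i = castAdd m j`
  have hlam_mu : ∀ i, lam i = μ → ∃ j : Fin m, Fin.castAdd m j = i := by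
    intro i hi
    change Sum.elim (fun _ => μ) (fun _ => -μ) (finSumFinEquiv.symm i) = μ at hi
    generalize hj : finSumFinEquiv.symm i = j at hi
    rcases j with k | k
    · exact ⟨k, by rw [← finSumFinEquiv_apply_left, ← hj, Equiv.apply_symm_apply]⟩
    · exfalso
      simp only [Sum.elim_inr] at hi
      -- `-μ = μ` forces `μ = 0`
      have : (2 : ℂ) * μ = 0 := by linear_combination (-1 : ℂ) * hi
      exact hμ0 ((mul_eq_zero.mp this).resolve_left two_ne_zero)
  -- the wedge basis of `H²ⁿ` and the action of the test endomorphisms on it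
  let Bw : Module.Basis (Set.powersetCard (Fin (m + m)) (2 * n)) ℂ (complexBetti B.X (2 * n)) :=
    (b.exteriorPower (2 * n)).map (hΛ.equiv (2 * n))
  have hBw : ∀ S, Bw S = cupPowOne ℂ (Motives.ComplexPoints B.X) (2 * n)
      (b ∘ (Set.powersetCard.ofFinEmbEquiv.symm S)) := by
    intro S
    change hΛ.equiv (2 * n) ((b.exteriorPower (2 * n)) S) = _
    rw [exteriorPower.basis_apply, HasExteriorCohomologyH1.equiv_apply, exteriorPower.ιMulti_family,
      wedgeToCup_ιMulti]
  have hact : ∀ (p : ℕ × ℕ) (S : Set.powersetCard (Fin (m + m)) (2 * n)),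
      (complexBetti.map (p.1 • 𝟙 B + p.2 • ψ).hom.hom.hom (2 * n)).hom (Bw S) =
        (∏ i : Fin (2 * n), ((p.1 : ℂ) + (p.2 : ℂ) * lam (Set.powersetCard.ofFinEmbEquiv.symm S i))) •
          Bw S := by
    rintro ⟨x, y⟩ S
    rw [hBw]
    change singularCohomology.map ℂ ℂ
      (Motives.AlgPoints.mapContinuous (L := ℂ) (x • 𝟙 B + y • ψ).hom.hom.hom) (2 * n)
        (cupPowOne ℂ _ (2 * n) _) = _
    rw [map_cupPowOne]
    have e : (fun i => singularCohomology.map ℂ ℂ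
        (Motives.AlgPoints.mapContinuous (L := ℂ) (x • 𝟙 B + y • ψ).hom.hom.hom) 1
          ((b ∘ (Set.powersetCard.ofFinEmbEquiv.symm S)) i)) =
        fun i => ((x : ℂ) + (y : ℂ) * lam (Set.powersetCard.ofFinEmbEquiv.symm S i)) •
          (b ∘ (Set.powersetCard.ofFinEmbEquiv.symm S)) i := by
      funext i
      exact complexBetti_map_nsmul_id_add_nsmul_one_of_mem_eigenspace (hb_mem _) x y
    rw [e, MultilinearMap.map_smul_univ]
  -- every `2n`-subset `S` of the `m + m` indices contains a `(-μ)`-index, since `m < 2n`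
  have hneg : ∀ S : Set.powersetCard (Fin (m + m)) (2 * n),
      ∃ k : Fin (2 * n), (lam ∘ Set.powersetCard.ofFinEmbEquiv.symm S) k = -μ := by
    intro S
    by_contra hall
    have hpos : ∀ k : Fin (2 * n), lam (Set.powersetCard.ofFinEmbEquiv.symm S k) = μ := fun k =>
      (hlam _).resolve_right fun h => hall ⟨k, h⟩
    -- every element of `S` lies in the first block
    have hsub : ∀ i ∈ (S : Finset (Fin (m + m))), (i : ℕ) ∈ Finset.range m := by
      intro i hi
      obtain ⟨k, hk⟩ := (Set.powersetCard.mem_range_ofFinEmbEquiv_symm_iff_mem S i).2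
        (Set.powersetCard.mem_coe_iff.1 hi)
      obtain ⟨j, hj⟩ := hlam_mu i (by rw [← hk]; exact hpos k)
      rw [Finset.mem_range, ← hj, Fin.val_castAdd]
      exact j.isLt
    have hcard : (S : Finset (Fin (m + m))).card ≤ (Finset.range m).card :=
      Finset.card_le_card_of_injOn (fun i : Fin (m + m) => (i : ℕ)) hsub
        (fun i _ j _ hij => Fin.ext hij)
    rw [Set.powersetCard.card_eq, Finset.card_range] at hcard
    omega
  -- all wedge coordinates of the joint eigenvector `c` vanish
  have hcoord : ∀ S, Bw.repr c S = 0 := by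
    intro S
    obtain ⟨x, y, hxy⟩ := exists_prod_natCast_add_mul_ne_pow hμ0
      (lam ∘ Set.powersetCard.ofFinEmbEquiv.symm S) (fun k => hlam _) (hneg S)
    have h0 := repr_apply_sub_smul_of_diagonal (P := ℕ × ℕ) Bw
      (fun p => (complexBetti.map (p.1 • 𝟙 B + p.2 • ψ).hom.hom.hom (2 * n)).hom)
      (fun S p => ∏ i : Fin (2 * n), ((p.1 : ℂ) + (p.2 : ℂ) * lam (Set.powersetCard.ofFinEmbEquiv.symm S i)))
      hact (fun p => ((p.1 : ℂ) + (p.2 : ℂ) * μ) ^ (2 * n)) (x, y) c S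
    have hcp : (complexBetti.map (x • 𝟙 B + y • ψ).hom.hom.hom (2 * n)).hom c = ((x : ℂ) + (y : ℂ) * μ) ^ (2 * n) • c :=
      (mem_pullbackEigenclasses_iff.mp hc) x y
    have hcp' : (fun p : ℕ × ℕ => (complexBetti.map (p.1 • 𝟙 B + p.2 • ψ).hom.hom.hom (2 * n)).hom) (x, y) c -
        (fun p : ℕ × ℕ => ((p.1 : ℂ) + (p.2 : ℂ) * μ) ^ (2 * n)) (x, y) • c = 0 := by
      simp only [hcp, sub_self]
    rw [hcp', map_zero, Finsupp.zero_apply] at h0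
    rcases mul_eq_zero.mp h0.symm with h1 | h1
    · exact absurd (sub_eq_zero.mp h1) hxy
    · exact h1
  exact Bw.ext_elem fun S => by rw [hcoord, map_zero, Finsupp.zero_apply]

/-- **(S1) Weil classes vanish on `K`-stable abelian subvarieties of dimension `< 2n`** (C807 (b)(ii′)): let `ι : B ⟶ P` be a morphism
of complex abelian varieties intertwining `ψ_B` (`ψ_B ≫ ψ_B = −d`, `d ≥ 1`) with `ψ₀` — `ι ≫ ψ₀ = ψ_B ≫ ι` (e.g. the inclusion of a
`ψ₀`-stable abelian subvariety, or a translate composed with it) — and `dim B < 2n`. Then `ι^* w = 0` for every `w` in the Weil plane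
`weilClassesOf P ψ₀ n d ⊆ H²ⁿ(P(ℂ); ℂ)`. Consequence (the sieve, C807 (b)(iii)): restricted to such a `B`, a seed class `q·hⁿ + w` is
indistinguishable from `q·hⁿ`. [cite: vanGeemen1994HodgeAV, 4.9 and proof of Thm. 6.12] -/
theorem nsc_sieve_weilClassesOf_map_eq_zero_of_dim_lt {P B : AbelianVariety ℂ} {ψ₀ : P ⟶ P} {ψB : B ⟶ B} {n d : ℕ}
    (hd : 0 < d) (hψB : ψB ≫ ψB = -(d • 𝟙 B)) (ι : B ⟶ P) (hι : ι ≫ ψ₀ = ψB ≫ ι) (hB : B.dim < 2 * n)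
    {w : complexBetti P.X (2 * n)} (hw : w ∈ weilClassesOf P ψ₀ n d) :
    complexBetti.map ι.hom.hom.hom (2 * n) w = 0 := by
  rw [weilClassesOf, Submodule.mem_sup] at hw
  obtain ⟨c₁, h₁, c₂, h₂, rfl⟩ := hw
  have eplus : (fun x y : ℕ => ((x : ℂ) + (y : ℂ) * Complex.I * (Real.sqrt d : ℂ)) ^ (2 * n)) =
      fun x y : ℕ => ((x : ℂ) + (y : ℂ) * (Complex.I * (Real.sqrt d : ℂ))) ^ (2 * n) := by
    funext x y; rw [mul_assoc]
  have eminus : (fun x y : ℕ => ((x : ℂ) - (y : ℂ) * Complex.I * (Real.sqrt d : ℂ)) ^ (2 * n)) =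
      fun x y : ℕ => ((x : ℂ) + (y : ℂ) * (-(Complex.I * (Real.sqrt d : ℂ)))) ^ (2 * n) := by
    funext x y; rw [mul_neg, mul_assoc, sub_eq_add_neg]
  have h₁' := nsc_sieve_map_mem_pullbackEigenclasses ι hι h₁
  have h₂' := nsc_sieve_map_mem_pullbackEigenclasses ι hι h₂
  rw [eplus, nsc_sieve_pullbackEigenclasses_pow_eq_bot_of_dim_lt hd hψB hB (Or.inl rfl), Submodule.mem_bot] at h₁'
  rw [eminus, nsc_sieve_pullbackEigenclasses_pow_eq_bot_of_dim_lt hd hψB hB (Or.inr rfl), Submodule.mem_bot] at h₂'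
  rw [map_add, h₁', h₂', add_zero]

/-! ### (S2) a seed meets every test cycle seen by a power of `h` -/

/-- `hᵏ ⌣ (q·hⁿ + w) = q·h^{k+n} + hᵏ ⌣ w` — bilinearity of `⌣` and `hᵏ ⌣ hⁿ = h^{k+n}` (associativity, by induction on `n`).
[cite: Hatcher2002, §3.2 p. 211] -/
theorem nsc_sieve_cupPow_cup_seedClass {Y : Type} [TopologicalSpace Y] (h : singularCohomology ℂ ℂ Y 2) (q : ℂ) (k n : ℕ)
    (hkn : 2 * k + 2 * n = 2 * (k + n)) (w : singularCohomology ℂ ℂ Y (2 * n)) :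
    cupProduct hkn (cupPowTwo h k) (q • cupPowTwo h n + w) = q • cupPowTwo h (k + n) + cupProduct hkn (cupPowTwo h k) w := by
  have aux : ∀ (j : ℕ) (e : 2 * k + 2 * j = 2 * (k + j)),
      cupProduct e (cupPowTwo h k) (cupPowTwo h j) = cupPowTwo h (k + j) := by
    intro j
    induction j with
    | zero => intro e; exact cupProduct_one _
    | succ j ih =>
      intro e
      have e' : 2 * k + 2 * j = 2 * (k + j) := by omega
      rw [cupPowTwo_succ h j, ← cupProduct_assoc e' (two_mul_add_two j) (two_mul_add_two (k + j)) e, ih e']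
      exact (cupPowTwo_succ h (k + j)).symm
  rw [map_add, map_smul, aux n hkn]

/-- **(S2) the seed meets every test cycle that `h^{n+k}` sees** (C807 (b)(ii)). On a complex abelian `2n`-fold `(P, ψ₀)` with
`ψ₀ ≫ ψ₀ = −d` (`d ≥ 1`) let `h ∈ H²` be `K`-symmetric (`ψ₀^* h = d·h`, e.g. a `K`-symmetrised hyperplane class), `w` a Weil class, and
suppose the SEED CLASS `q·hⁿ + w` (`q ≠ 0`) is supported on the Zariski-closed set `Z` while a class `f` is supported on the
Zariski-closed set `V`. If `h^{n+k} ⌣ f ≠ 0` for some `k ≥ 1`, then `Z ∩ V ≠ ∅`. Typical use: `V` a closed subvariety of dimension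
`n + k` with `f = [V]`, `h^{n+k} ⌣ [V] = deg_h V · [pt] ≠ 0` — the seed meets EVERY closed subvariety of dimension `≥ n + 1`; with (S1),
every translate of a `ψ₀`-stable abelian `n`-fold as well. [cite: Fulton1998, §19.2 Cor. 19.2] [cite: vanGeemen1994HodgeAV, proof of Lemma 5.2 (6)] -/
theorem nsc_sieve_inter_nonempty_of_seedClass_of_cupPow_ne_zero {P : AbelianVariety ℂ} {ψ₀ : P ⟶ P} {n d : ℕ}
    (hP : P.dim = 2 * n) (hd : 0 < d) (hψ : ψ₀ ≫ ψ₀ = -(d • 𝟙 P)) {h : complexBetti P.X 2}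
    (hh : complexBetti.map ψ₀.hom.hom.hom 2 h = (d : ℂ) • h) {w : complexBetti P.X (2 * n)} (hw : w ∈ weilClassesOf P ψ₀ n d)
    {q : ℂ} (hq : q ≠ 0) {Z V : Set P.X.left} (hZ : IsClosed Z) (hV : IsClosed V)
    (hseed : q • cupPowTwo h n + w ∈ classesSupportedOn P.X Z (2 * n)) {j : ℕ} {f : complexBetti P.X j}
    (hf : f ∈ classesSupportedOn P.X V j) {k : ℕ} (hk : 0 < k) {s : ℕ} (hs : 2 * (k + n) + j = s)
    (hne : cupProduct hs (cupPowTwo h (k + n)) f ≠ 0) :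
    (Z ∩ V).Nonempty := by
  by_contra hempty
  rw [Set.not_nonempty_iff_eq_empty] at hempty
  have hkn : 2 * k + 2 * n = 2 * (k + n) := by ring
  -- `hᵏ ⌣ (q hⁿ + w) = q h^{k+n}` is supported on `Z`
  have hcup : cupProduct hkn (cupPowTwo h k) (q • cupPowTwo h n + w) = q • cupPowTwo h (k + n) := by
    rw [nsc_sieve_cupPow_cup_seedClass h q k n hkn w,
      cupProduct_cupPowTwo_eq_zero_of_map_eq_smul_of_mem_weilClassesOf hP hd hψ hh hw hk hkn, add_zero]
  have hZ' : q • cupPowTwo h (k + n) ∈ classesSupportedOn P.X Z (2 * (k + n)) := by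
    rw [← hcup, ← Set.univ_inter Z]
    exact cupProduct_mem_classesSupportedOn_inter isClosed_univ hZ hkn
      (by rw [classesSupportedOn_univ]; exact Submodule.mem_top) hseed
  -- hence `q h^{k+n} ⌣ f` is supported on `Z ∩ V = ∅`, i.e. vanishes
  have h0 : cupProduct hs (q • cupPowTwo h (k + n)) f ∈ classesSupportedOn P.X (Z ∩ V) s :=
    cupProduct_mem_classesSupportedOn_inter hZ hV hs hZ' hf
  rw [hempty, classesSupportedOn_empty, Submodule.mem_bot, map_smul, LinearMap.smul_apply, smul_eq_zero] at h0
  exact h0.elim hq hne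

/-! ### (S3) the degree-8/10 bookkeeping of the higher sieve (pure algebra) -/

/-- **(S3a) the classes of `Z` on its resolution**: with `K_Z = 2ξ + c₁F` and `c₂(T_Z) = 3ξ² + 3ξ·c₁F + c₁F² + c₂E − c₂F` (C815 (b): `Z ≅ Z(s)
⊂ ℙ(E)`, `ξ = c₁𝒪(1)`, relative canonical class and `c(T_Z) = c(T_{ℙ(E)})/c(π^*F ⊗ 𝒪(1))` restricted), the degree-10 datum is
`K_Z² + c₂(T_Z) = 7ξ² + 7c₁F·ξ + (2c₁F² + c₂E − c₂F)`. [cite: Fulton1998, §3.2 Example 3.2.11 and §14.4] -/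
theorem nsc_sieve_resolution_KZ_sq_add_c2 {R : Type*} [CommRing R] (ξ c₁F c₂E c₂F K c₂T : R)
    (hK : K = 2 * ξ + c₁F) (hc₂ : c₂T = 3 * ξ ^ 2 + 3 * ξ * c₁F + c₁F ^ 2 + c₂E - c₂F) :
    K ^ 2 + c₂T = 7 * ξ ^ 2 + 7 * c₁F * ξ + (2 * c₁F ^ 2 + c₂E - c₂F) := by
  subst hK hc₂
  ring

/-- **(S3b) the push-forward bookkeeping**: with `i_*((x₀ + x₁ξ + x₂ξ²)|_Z) = x₀·c₃ + x₁·c₄ + x₂·c₅` (`c_k = c_k(F − E)`, `i_*(ξᵃ|_Z) = c_{3+a}(F − E)`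
by `π_*ξ^{r−1+a} = s_a(E)` and the projection formula), `S₈ := i_*K_Z = 2c₄ + c₁F·c₃` and
`S₁₀ := i_*(K_Z² + c₂(T_Z)) = 7c₅ + 7c₁F·c₄ + (2c₁F² + c₂E − c₂F)·c₃` — the two classes that C815 (a) requires to lie on the lines `ℚ·h⁴`,
`ℚ·h⁵` (pv2-g7's (V)–(VII) in the normalisation of the tensor point). [cite: Fulton1998, §3.2 Prop. 3.1 (a) and §14.4] -/
theorem nsc_sieve_pushforward_S8_S10 {R : Type*} [CommRing R] (c₁F c₂E c₂F c₃ c₄ c₅ : R) (push : R → R → R → R)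
    (hpush : ∀ x₀ x₁ x₂, push x₀ x₁ x₂ = x₀ * c₃ + x₁ * c₄ + x₂ * c₅) :
    push c₁F 2 0 = 2 * c₄ + c₁F * c₃ ∧
      push (2 * c₁F ^ 2 + c₂E - c₂F) (7 * c₁F) 7 = 7 * c₅ + 7 * c₁F * c₄ + (2 * c₁F ^ 2 + c₂E - c₂F) * c₃ := by
  refine ⟨?_, ?_⟩ <;> rw [hpush] <;> ring

/-- **(S3c) Grothendieck–Riemann–Roch in degrees 4 and 5 with `td(P) = 1`**: `ch(i_*𝒪_Z) = i_*(td(T_Z))`, `td₁ = c₁/2 = −K_Z/2`,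
`td₂ = (c₁² + c₂)/12 = (K_Z² + c₂)/12`; so `ch₄(i_*𝒪_Z) = −½·S₈`, `ch₅ = S₁₀/12`, and in any `ℚ`-module «`ch_k ∈ ℚ·hᵏ`» is «`S_k ∈ ℚ·hᵏ`»
(the lines are `ℚ`-subspaces and the scalars `−½`, `1/12` are invertible). [cite: Fulton1998, §15.2 Thm. 15.2 and Example 15.2.16] -/
theorem nsc_sieve_grr_degrees_four_five {M : Type*} [AddCommGroup M] [Module ℚ M] (S₈ S₁₀ h₄ h₅ ch₄ ch₅ : M)
    (h4 : ch₄ = (-(1 / 2 : ℚ)) • S₈) (h5 : ch₅ = (1 / 12 : ℚ) • S₁₀) :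
    (ch₄ ∈ ℚ ∙ h₄ ↔ S₈ ∈ ℚ ∙ h₄) ∧ (ch₅ ∈ ℚ ∙ h₅ ↔ S₁₀ ∈ ℚ ∙ h₅) := by
  subst h4 h5
  refine ⟨?_, ?_⟩
  · refine ⟨fun hm => ?_, fun hm => Submodule.smul_mem _ _ hm⟩
    have := Submodule.smul_mem (ℚ ∙ h₄) (-2 : ℚ) hm
    rwa [smul_smul, show (-2 : ℚ) * (-(1 / 2 : ℚ)) = 1 by norm_num, one_smul] at this
  · refine ⟨fun hm => ?_, fun hm => Submodule.smul_mem _ _ hm⟩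
    have := Submodule.smul_mem (ℚ ∙ h₅) (12 : ℚ) hm
    rwa [smul_smul, show (12 : ℚ) * (1 / 12 : ℚ) = 1 by norm_num, one_smul] at this

/-- **(S3d) «`ch ∈ ℚ[h] ⊕ W` ⟹ the listed coefficient identities»**: in a `ℚ`-module, if `hᵏ` together with the test monomials `ηᵢ`
(`i ∈ ι`) is a linearly independent family (on a Weil-type `2n`-fold: `h·W = 0 = η·W` kills all mixed terms, so the `Γ`-invariant
classes of degrees `4`, `5` are `ℚhᵏ ⊕ ⟨η-monomials⟩`, C814 (ε) / C815 (b)), then `a·hᵏ + Σᵢ bᵢ·ηᵢ ∈ ℚ·hᵏ` forces `bᵢ = 0` for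
every `i` — the DEFECT coordinates of C815 (c) must vanish. [folklore] -/
theorem nsc_sieve_coeff_eq_zero_of_mem_span {M : Type*} [AddCommGroup M] [Module ℚ M] {ι : Type*} [Fintype ι]
    (v : Option ι → M) (hv : LinearIndependent ℚ v) (a : ℚ) (b : ι → ℚ)
    (hmem : a • v none + ∑ i, b i • v (some i) ∈ ℚ ∙ v none) : ∀ i, b i = 0 := by
  classical
  obtain ⟨r, hr⟩ := Submodule.mem_span_singleton.mp hmem
  -- the relation `(a - r)·v none + Σ bᵢ·v (some i) = 0`, read through `Fintype.linearIndependent_iff`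
  have key := (Fintype.linearIndependent_iff.mp hv) (fun o => Option.elim o (a - r) b) (by
    rw [Fintype.sum_option]
    change (a - r) • v none + ∑ i, b i • v (some i) = 0
    rw [sub_smul, hr]
    abel)
  intro i
  exact key (some i)

end NscSeedSieve

end Summit.HodgeConjecture.HodgeConjecture.WeilTypeLadder

end
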